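import Summits.BirchSwinnertonDyer.BirchSwinnertonDyer.Theorems.SignedLowerHalvesKobayashiLowerHalfSemistableDefmuMuLayerZero
import HarnessLib

/-!
# The kernels `ker(Pic(𝒪_{p^{k+1+j}}) → Pic(𝒪_{p^{k+1}}))` are cyclic; `Δ ↠ Δ` and `Δ ↪` along many steps; maximality of `Δ`

Route-independent `Theorems` file (cell `b2b-bsdres`, seat `b2b-bsdres-x10b`, gen 44), part 5 of the series «tower square root»
serving crux `DerivedHeightCap` (stmt-BirchSwinnertonDyer-18438, route DefiniteTheta), registered stub `stub_towerSqrt`; sequel of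
the `torsionImage` files of gen 43 (`…DefmuTorsionImageKernels/Tower`, `…DefmuMuLayerZero`).
HONEST FRAMING: no curve asserted, no class closed, BSD not proved by any of this.

`K` imaginary quadratic, `p` an odd prime, `G̃_m = Pic(𝒪_{p^m})`, `Δ_m = torsionImage K p m` (image of the torsion of
`G̃_∞ = lim G̃_m`), `N_{M,B} = ker(G̃_M → G̃_B)`. Levels are written `M = k + 1 + j` with a free `M` (dependent types).

* §1 `ker_le_zpowers`: for `h ∈ N_{M,k+1}` not dying in `G̃_{k+2}` (when `j ≥ 1`), `N_{M,k+1} ⊆ ⟨h⟩` — the multi-step kernels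
  above level `1` are CYCLIC (order growth `pow_pow_ne_one_of_picRes` + the one-step kernels of order `p`); such `h` exist
  (`exists_kernel_generator`), `h^{p^j} = 1`, `h^{p^{j-1}} ≠ 1`.
* §2 `exists_mem_torsionImage_picRes_eq_tower` (`Δ_M ↠ Δ_{k+1}`), `eq_one_of_mem_torsionImage_of_picRes_eq_one_tower`
  (`Δ_M ∩ N_{M,k+1} = 1`), `pow_natCard_torsionImage_eq_one` (elements of `Δ_M` are killed by `#Δ_{k+1}`).
* §3 `mem_torsionImage_of_forall_lift` (MAXIMALITY of `Δ` seen from the quotient tower): if `x ∈ G̃_{k+1}` admits at every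
  level `M ≥ k+1` a lift `y` with `y^p ∈ Δ_M`, then `x ∈ Δ_{k+1}` (the lifts have the bounded exponent `p · #Δ_{k+1}`).
* §4 `isPGroup_acLayerGroup`: `G̃_{k+1}/Δ = AcLayerGroup K p (k+1)` is a `p`-group (the prime-to-`p` part lies in `Δ`).

## References
* [BertoliniDarmon2005] §1.2 (18)–(21) (`G̃_∞ = Δ × G_∞`, `G_∞ ≅ ℤ_p`); [DarmonIovita2008] §2.2; [Cox2013] §7.D Thm. 7.24.
-/

noncomputable section

open scoped BigOperators

-- D-0017: single-problem summit, the namespace repeats the problem name by design.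
set_option linter.dupNamespace false

namespace Summit.BirchSwinnertonDyer.BirchSwinnertonDyer.Theorems.TowerSqrt

open Literature.NumberTheory.EllipticCurves Literature.NumberTheory.EllipticCurves.QuadOrderTower NumberField
open Summit.BirchSwinnertonDyer.BirchSwinnertonDyer.Theorems.DefmuSupersingularTheta
  (natCard_ker_picRes pow_eq_one_of_picRes_eq_one pow_pow_ne_one_of_picRes eq_one_of_mem_torsionImage_of_picRes_eq_one
   exists_mem_torsionImage_picRes_eq picRes_mem_torsionImage pow_pow_eq_one_of_picRes_eq_one_tower picRes_surjective_tower
   mem_torsionImage_of_coprime_orderOf)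

universe u

variable {K : Type u} [Field K] [NumberField K] (p : ℕ) [hp : Fact p.Prime]

/-! ### §1 The multi-step kernels above level `1` are cyclic -/

/-- **`N_{M,k+1} ⊆ ⟨h⟩`** for `M = k+2+j` and any `h ∈ N_{M,k+1}` with `res_{M → k+2} h ≠ 1`: the kernel of
`Pic(𝒪_{p^{k+2+j}}) → Pic(𝒪_{p^{k+1}})` is cyclic, generated by any of its elements not dying in `Pic(𝒪_{p^{k+2}})` (induction on
`j`: modulo `⟨h⟩` an element of the kernel dies one level down, and the one-step kernel, of order `p`, is generated by
`h^{p^j} ≠ 1`). [cite: BertoliniDarmon2005, §1.2 (18)–(21)] [cite: Cox2013, §7.D Thm. 7.24] -/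
theorem ker_le_zpowers (hK : IsImaginaryQuadratic K) (hp2 : p ≠ 2) (k j : ℕ) :
    ∀ (M : ℕ) (hM : M = k + 2 + j) (h : ClassGroup (quadOrder K (p ^ M))),
      picRes K (pow_dvd_pow p (by omega : k + 1 ≤ M)) h = 1 →
      picRes K (pow_dvd_pow p (by omega : k + 2 ≤ M)) h ≠ 1 →
      ∀ n : ClassGroup (quadOrder K (p ^ M)), picRes K (pow_dvd_pow p (by omega : k + 1 ≤ M)) n = 1 →
        n ∈ Subgroup.zpowers h := by
  induction j with
  | zero =>
    intro M hM h h1 h2 n hn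
    subst hM
    have h2' : h ≠ 1 := fun he => h2 (by rw [he, map_one])
    have hcard : Nat.card (picRes K (pow_dvd_pow p (k + 1).le_succ)).ker = p := natCard_ker_picRes p hK k
    have hmem : (⟨n, hn⟩ : (picRes K (pow_dvd_pow p (k + 1).le_succ)).ker) ∈
        Subgroup.zpowers (⟨h, h1⟩ : (picRes K (pow_dvd_pow p (k + 1).le_succ)).ker) :=
      mem_zpowers_of_prime_card hcard (fun heq => h2' (congrArg Subtype.val heq))
    obtain ⟨z, hz⟩ := Subgroup.mem_zpowers_iff.mp hmem
    have hz' : h ^ z = n := by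
      have := congrArg Subtype.val hz
      simpa using this
    rw [← hz']
    exact Subgroup.zpow_mem _ (Subgroup.mem_zpowers h) _
  | succ j ih =>
    intro M hM h h1 h2 n hn
    have hM' : M = (k + j + 1) + 2 := by omega
    subst hM'
    -- one level down
    set h' := picRes K (pow_dvd_pow p (k + j + 1 + 1).le_succ) h with hh'
    set n' := picRes K (pow_dvd_pow p (k + j + 1 + 1).le_succ) n with hn'
    have h1' : picRes K (pow_dvd_pow p (by omega : k + 1 ≤ k + j + 1 + 1)) h' = 1 := by
      rw [hh', picRes_picRes]; exact h1
    have h2' : picRes K (pow_dvd_pow p (by omega : k + 2 ≤ k + j + 1 + 1)) h' ≠ 1 := by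
      rw [hh', picRes_picRes]; exact h2
    have hn1 : picRes K (pow_dvd_pow p (by omega : k + 1 ≤ k + j + 1 + 1)) n' = 1 := by
      rw [hn', picRes_picRes]; exact hn
    obtain ⟨a, ha⟩ := Subgroup.mem_zpowers_iff.mp (ih (k + j + 1 + 1) (by omega) h' h1' h2' n' hn1)
    -- n * h^{-a} lies in the one-step kernel, which has order p and contains h^{p^{j+1}} ≠ 1
    have hker : picRes K (pow_dvd_pow p (k + j + 1 + 1).le_succ) (n * (h ^ a)⁻¹) = 1 := by
      rw [map_mul, map_inv, map_zpow, ← hh', ha, ← hn', mul_inv_cancel]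
    have hu1 : picRes K (pow_dvd_pow p (k + j + 1 + 1).le_succ) (h ^ p ^ (j + 1)) = 1 := by
      rw [map_pow, ← hh']
      exact pow_pow_eq_one_of_picRes_eq_one_tower p hK (j + 1) k (k + j + 1 + 1) (by omega) h' h1'
    have hu2 : h ^ p ^ (j + 1) ≠ 1 :=
      pow_pow_ne_one_of_picRes p hK hp2 (j + 1) k (k + j + 1 + 2) (by omega) h h1 h2
    have hcard : Nat.card (picRes K (pow_dvd_pow p (k + j + 1 + 1).le_succ)).ker = p :=
      natCard_ker_picRes p hK (k + j + 1)
    -- inside the kernel (a group of prime order) every element is a power of h^{p^{j+1}}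
    have hmem : (⟨n * (h ^ a)⁻¹, hker⟩ : (picRes K (pow_dvd_pow p (k + j + 1 + 1).le_succ)).ker) ∈
        Subgroup.zpowers (⟨h ^ p ^ (j + 1), hu1⟩ : (picRes K (pow_dvd_pow p (k + j + 1 + 1).le_succ)).ker) :=
      mem_zpowers_of_prime_card hcard (fun heq => hu2 (congrArg Subtype.val heq))
    obtain ⟨z, hz⟩ := Subgroup.mem_zpowers_iff.mp hmem
    have hz' : (h ^ p ^ (j + 1)) ^ z = n * (h ^ a)⁻¹ := by
      have := congrArg Subtype.val hz
      simpa using this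
    have hn_eq : n = h ^ (a + (p ^ (j + 1) : ℕ) * z) := by
      rw [zpow_add, zpow_mul, zpow_natCast, hz', mul_comm, inv_mul_cancel_right]
    rw [hn_eq]
    exact Subgroup.zpow_mem _ (Subgroup.mem_zpowers h) _

/-- **Kernel generators exist**: for `M = k+2+j` there is `h ∈ N_{M,k+1}` with `res_{M→k+2} h ≠ 1` (a non-trivial element of
the one-step kernel `N_{k+2,k+1}`, which has order `p`, lifted to level `M`). [cite: Cox2013, §7.D Thm. 7.24] -/
theorem exists_kernel_generator (hK : IsImaginaryQuadratic K) (k j : ℕ) :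
    ∀ (M : ℕ) (hM : M = k + 2 + j), ∃ h : ClassGroup (quadOrder K (p ^ M)),
      picRes K (pow_dvd_pow p (by omega : k + 1 ≤ M)) h = 1 ∧
      picRes K (pow_dvd_pow p (by omega : k + 2 ≤ M)) h ≠ 1 := by
  intro M hM
  haveI : Finite (ClassGroup (quadOrder K (p ^ (k + 2)))) := finite_classGroup (K := K) _
  -- a non-trivial element of the one-step kernel at level k+2
  have hcard : Nat.card (picRes K (pow_dvd_pow p (k + 1).le_succ)).ker = p := natCard_ker_picRes p hK k
  haveI : Nontrivial (picRes K (pow_dvd_pow p (k + 1).le_succ)).ker := by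
    have h1 : 1 < Nat.card (picRes K (pow_dvd_pow p (k + 1).le_succ)).ker := by rw [hcard]; exact hp.out.one_lt
    exact Finite.one_lt_card_iff_nontrivial.mp h1
  obtain ⟨⟨g, hg⟩, hg1⟩ := exists_ne (1 : (picRes K (pow_dvd_pow p (k + 1).le_succ)).ker)
  have hg1' : g ≠ 1 := fun h => hg1 (Subtype.ext h)
  obtain ⟨h, hh⟩ := picRes_surjective_tower p hK j (k + 1) M (by omega) g
  refine ⟨h, ?_, ?_⟩
  · have : picRes K (pow_dvd_pow p (k + 1).le_succ) (picRes K (pow_dvd_pow p (by omega : k + 2 ≤ M)) h) = 1 := by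
      rw [hh]; exact hg
    rwa [picRes_picRes] at this
  · rw [hh]; exact hg1'

/-- Orders in the kernels: `h^{p^j} = 1` for `h ∈ N_{k+1+j, k+1}` (restated from part «MuLayerZero» §1 for convenience) and
`h^{p^{j'}} ≠ 1` for `j = j' + 1` when `res_{→k+2} h ≠ 1`. [cite: Cox2013, §7.D Thm. 7.24] -/
theorem zpow_prime_pow_eq_one_iff_dvd (hK : IsImaginaryQuadratic K) (hp2 : p ≠ 2) (k j' : ℕ) (M : ℕ) (hM : M = k + 2 + j')
    (h : ClassGroup (quadOrder K (p ^ M))) (h1 : picRes K (pow_dvd_pow p (by omega : k + 1 ≤ M)) h = 1)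
    (h2 : picRes K (pow_dvd_pow p (by omega : k + 2 ≤ M)) h ≠ 1) (a : ℤ) :
    (∃ ν : ClassGroup (quadOrder K (p ^ M)), ν ∈ Subgroup.zpowers h ∧ ν ^ p = h ^ a) ↔ (p : ℤ) ∣ a := by
  have hord1 : h ^ p ^ (j' + 1) = 1 := pow_pow_eq_one_of_picRes_eq_one_tower p hK (j' + 1) k M (by omega) h h1
  have hord2 : h ^ p ^ j' ≠ 1 := pow_pow_ne_one_of_picRes p hK hp2 j' k M hM h h1 h2
  have hord : orderOf h = p ^ (j' + 1) := by
    obtain ⟨i, hi, heq⟩ := (Nat.dvd_prime_pow hp.out).mp (orderOf_dvd_of_pow_eq_one hord1)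
    rw [heq]
    rcases Nat.lt_or_ge i (j' + 1) with hlt | hge
    · exfalso
      apply hord2
      have : orderOf h ∣ p ^ j' := heq ▸ pow_dvd_pow p (by omega)
      exact orderOf_dvd_iff_pow_eq_one.mp this
    · have : i = j' + 1 := le_antisymm hi hge
      rw [this]
  constructor
  · rintro ⟨ν, hν, hνp⟩
    obtain ⟨b, rfl⟩ := Subgroup.mem_zpowers_iff.mp hν
    rw [← zpow_natCast, ← zpow_mul] at hνp
    -- h^{bp} = h^a ⇒ ord h ∣ a - bp
    have hdvd : (orderOf h : ℤ) ∣ a - b * p := (zpow_eq_zpow_iff_modEq.mp hνp).dvd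
    rw [hord] at hdvd
    push_cast at hdvd
    have hp1 : (p : ℤ) ∣ (p : ℤ) ^ (j' + 1) := dvd_pow_self _ (by omega)
    have h3 : (p : ℤ) ∣ (a - b * p) + b * p := dvd_add (hp1.trans hdvd) (dvd_mul_left _ _)
    rwa [sub_add_cancel] at h3
  · rintro ⟨c, rfl⟩
    exact ⟨h ^ c, Subgroup.zpow_mem _ (Subgroup.mem_zpowers h) c, by rw [← zpow_natCast, ← zpow_mul, mul_comm]⟩

/-! ### §2 `Δ` along many steps: onto, injective, of bounded exponent -/

omit hp in
/-- **`Δ_M ↠ Δ_{k+1}`** along `M = k+1+j → k+1` (iterate of the one-step `exists_mem_torsionImage_picRes_eq`, every `p`).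
[cite: BertoliniDarmon2005, §1.2 (21)] -/
theorem exists_mem_torsionImage_picRes_eq_tower [NeZero p] (k j : ℕ) :
    ∀ (M : ℕ) (hM : M = k + 1 + j) {t : ClassGroup (quadOrder K (p ^ (k + 1)))}, t ∈ torsionImage K p (k + 1) →
      ∃ t' ∈ torsionImage K p M, picRes K (pow_dvd_pow p (by omega : k + 1 ≤ M)) t' = t := by
  induction j with
  | zero =>
    intro M hM t ht
    subst hM
    exact ⟨t, ht, picRes_self _ t⟩
  | succ j ih =>
    intro M hM t ht
    have hM' : M = (k + 1 + j) + 1 := by omega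
    subst hM'
    obtain ⟨t₁, ht₁, ht₁t⟩ := ih (k + 1 + j) rfl ht
    obtain ⟨t₂, ht₂, ht₂t⟩ := exists_mem_torsionImage_picRes_eq p (k + 1 + j) ht₁
    refine ⟨t₂, ht₂, ?_⟩
    rw [← picRes_picRes (pow_dvd_pow p (by omega : k + 1 ≤ k + 1 + j)) (pow_dvd_pow p (k + 1 + j).le_succ), ht₂t, ht₁t]

/-- **`Δ_M ∩ N_{M,k+1} = 1`** (`M = k+1+j`; `K` imaginary quadratic, `p` odd): iterate of the one-step
`eq_one_of_mem_torsionImage_of_picRes_eq_one`. [cite: DarmonIovita2008, §2.2] [cite: BertoliniDarmon2005, §1.2 (21)] -/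
theorem eq_one_of_mem_torsionImage_of_picRes_eq_one_tower (hK : IsImaginaryQuadratic K) (hp2 : p ≠ 2) (k j : ℕ) :
    ∀ (M : ℕ) (hM : M = k + 1 + j) {t : ClassGroup (quadOrder K (p ^ M))}, t ∈ torsionImage K p M →
      picRes K (pow_dvd_pow p (by omega : k + 1 ≤ M)) t = 1 → t = 1 := by
  induction j with
  | zero =>
    intro M hM t _ ht1
    subst hM
    exact (picRes_self _ t).symm.trans ht1
  | succ j ih =>
    intro M hM t ht ht1
    have hM' : M = (k + j) + 2 := by omega
    subst hM'
    have hres : picRes K (pow_dvd_pow p (k + j + 1).le_succ) t = 1 := by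
      refine ih (k + j + 1) (by omega) (picRes_mem_torsionImage p (k + j + 1).le_succ ht) ?_
      rw [picRes_picRes]; exact ht1
    exact eq_one_of_mem_torsionImage_of_picRes_eq_one p hK hp2 (k + j) ht hres

/-- **Elements of `Δ_M` are killed by `#Δ_{k+1}`** (`M = k+1+j`): `res(t^{#Δ_{k+1}}) = (res t)^{#Δ_{k+1}} = 1` and §2 injectivity.
[cite: BertoliniDarmon2005, §1.2 (21)] -/
theorem pow_natCard_torsionImage_eq_one (hK : IsImaginaryQuadratic K) (hp2 : p ≠ 2) (k j : ℕ) (M : ℕ) (hM : M = k + 1 + j)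
    {t : ClassGroup (quadOrder K (p ^ M))} (ht : t ∈ torsionImage K p M) :
    t ^ Nat.card (torsionImage K p (k + 1)) = 1 := by
  refine eq_one_of_mem_torsionImage_of_picRes_eq_one_tower p hK hp2 k j M hM (Subgroup.pow_mem _ ht _) ?_
  rw [map_pow]
  have hmem : picRes K (pow_dvd_pow p (by omega : k + 1 ≤ M)) t ∈ torsionImage K p (k + 1) :=
    picRes_mem_torsionImage p (by omega) ht
  have := pow_card_eq_one' (G := torsionImage K p (k + 1)) (x := ⟨_, hmem⟩)
  exact congrArg Subtype.val this

/-! ### §3 Maximality of `Δ`: lifts with `p`-th power in `Δ` at all levels force membership in `Δ` -/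

/-- **Maximality of `Δ` seen from the quotient tower**: if `x ∈ G̃_{k+1}` has, at every level `M ≥ k+1`, a lift `y` with
`y^p ∈ Δ_M`, then `x ∈ Δ_{k+1}` (the lifts have the uniform exponent `p · #Δ_{k+1}`, §2). In the quotient tower
`G_m^{ac} = G̃_m/Δ_m` this says that its own "torsion image" is trivial — `G_∞ = G̃_∞/Δ` is torsion-free.
[cite: BertoliniDarmon2005, §1.2 (18)–(21)] -/
theorem mem_torsionImage_of_forall_lift (hK : IsImaginaryQuadratic K) (hp2 : p ≠ 2) (k : ℕ)
    (x : ClassGroup (quadOrder K (p ^ (k + 1))))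
    (hx : ∀ (j M : ℕ) (hM : M = k + 1 + j), ∃ y : ClassGroup (quadOrder K (p ^ M)),
      picRes K (pow_dvd_pow p (by omega : k + 1 ≤ M)) y = x ∧ y ^ p ∈ torsionImage K p M) :
    x ∈ torsionImage K p (k + 1) := by
  haveI : Finite (torsionImage K p (k + 1)) := by
    haveI := finite_classGroup (K := K) (p ^ (k + 1))
    infer_instance
  have hD : 0 < Nat.card (torsionImage K p (k + 1)) := Nat.card_pos
  refine ⟨p * Nat.card (torsionImage K p (k + 1)), Nat.mul_pos hp.out.pos hD, fun M hMle => ?_⟩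
  obtain ⟨j, hj⟩ := Nat.exists_eq_add_of_le hMle
  obtain ⟨y, hyx, hyp⟩ := hx j M hj
  refine ⟨y, ?_, hyx⟩
  rw [pow_mul]
  exact pow_natCard_torsionImage_eq_one p hK hp2 k j M hj hyp

/-! ### §4 `G̃_{k+1}/Δ` is a `p`-group -/

/-- **`AcLayerGroup K p (k+1)` is a `p`-group**: for `x` of order `p^a u` with `p ∤ u`, `x^{p^a}` has order prime to `p`, hence
lies in `Δ` (part «MuLayerZero» §3). [cite: BertoliniDarmon2005, §1.2 (21)] -/
theorem isPGroup_acLayerGroup (hK : IsImaginaryQuadratic K) (k : ℕ) :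
    IsPGroup p (ClassGroup (quadOrder K (p ^ (k + 1))) ⧸ torsionImage K p (k + 1)) := by
  intro q
  obtain ⟨x, rfl⟩ := QuotientGroup.mk'_surjective (torsionImage K p (k + 1)) q
  haveI : Finite (ClassGroup (quadOrder K (p ^ (k + 1)))) := finite_classGroup (K := K) _
  have hord : 0 < orderOf x := orderOf_pos x
  obtain ⟨a, u, hu, hau⟩ := Nat.exists_eq_pow_mul_and_not_dvd hord.ne' p hp.out.ne_one
  refine ⟨a, ?_⟩
  rw [← map_pow, QuotientGroup.mk'_apply, QuotientGroup.eq_one_iff]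
  refine mem_torsionImage_of_coprime_orderOf p hK k ?_
  have horda : orderOf (x ^ p ^ a) = u := by
    rw [orderOf_pow' x (pow_ne_zero a hp.out.ne_zero), hau, Nat.gcd_eq_right (Dvd.intro u rfl), Nat.mul_div_cancel_left u (pow_pos hp.out.pos a)]
  rw [horda]
  exact (Nat.Prime.coprime_iff_not_dvd hp.out).mpr hu |>.symm

end Summit.BirchSwinnertonDyer.BirchSwinnertonDyer.Theorems.TowerSqrt

end
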